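import Summits.BirchSwinnertonDyer.Rank1Residual.GaloisImage.LocalOneUnitsModPCount
import Summits.BirchSwinnertonDyer.Rank1Residual.GaloisImage.ModPLatticeHerbrandIterate
import Mathlib.RingTheory.RootsOfUnity.Basic
import HarnessLib

/-!
# `[U_1/U_1^p] = [𝒪_E/p] + [μ_p(E)]` for the one-units of a local field, counted by `#Hom_Δ(Z, ·)`
# (cell `b2b-bsdres`, team n1011, row T-EPC = Tate's local Euler–Poincaré characteristic; seat p04 GEN 7; stage B3)

HONEST FRAMING (cell `b2b-bsdres`, run/shared/lean/b2b/bsd-rank1-residual/, verbatim in every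
file): the goal of the cell is to DELETE the COMBINATION-SHAPED residual classes of the
Birch–Swinnerton-Dyer formula for ALL analytic-rank `≤ 1` elliptic curves over `ℚ` — "full BSD
formula for every rank `≤ 1` curve in class `C`" assembled STRICTLY from published theorems — so
that the rank-`≤ 1` remainder becomes exactly the CONSTRUCTION-SHAPED classes, which are TYPED
(missing-input `Prop`s), NOT attempted. This is not "finishing BSD". Team n1011 (N10 / N11, the
additive block X4 ∧ `p = 3`): research route; no claim beyond the stated classes; nothing is
booked; no mark / label is changed by this file. Theorems only (no definition, no named fact, no
`sorry`); TOOL theorems on local fields.  (Placement: Summits/GaloisImage pending the operator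
move of the T-EPC cone to the Literature homes of n1011-lit's placement word #2; relocatable.)

## What

`E/K` finite Galois, `E` a non-archimedean local field of characteristic `0` with `|p| < 1`,
`Δ = Gal(E/K)` of order prime to `p` acting on `Eˣ`.  For the one-units `U_1 ⊇ U_2 ⊇ U_3` of
stage B1 (`LocalOneUnitsGaloisModP`) and every finite `Δ`-module `Z` killed by `p`:

* `OneUnits.exists_digitHom_level` — the digit map `U_k → 𝒪_E/p`, `1 + p^k b ↦ b mod p`, for
  every `k ≥ 1` (surjective intertwining map, kernel `U_{k+1}`; stage B1 had `k = 2`);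
* `OneUnits.finite_ker_lsmul` — `U[p]` is finite (inside `μ_p(E)`), `finite_quotient_one`
  — `U_1/U_1^p` is finite;
* `OneUnits.natCard_modP_one` — **`#Hom_Δ(Z, U_1/U_1^p) = #Hom_Δ(Z, 𝒪_E/p) · #Hom_Δ(Z, U_1[p])`**:
  Milne's Lemma 2.12 step for `U_1 ⊇ U_2 ⊇ U_1^p` (stage A3, `U_2` torsion-free) combined with
  `U_2/U_2^p ≃ 𝒪_E/p` (stage B2) — the class identity `[U^{(p)}] = [R_L^{(p)}] + [U_p]` of the
  proof of *ADT* I Thm. 2.8, for `U = U_1`, in the counting currency of stage A1.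

References: J. S. Milne, *Arithmetic Duality Theorems* (2006), I §2, proof of Thm. 2.8, Lemma 2.12
[MilneADT2006]; J.-P. Serre, *Local Fields*, IV §2 Prop. 6 [SerreLocalFields1979].
-/

noncomputable section

open Function
open scoped ValuativeRel

namespace Summit.BirchSwinnertonDyer.Rank1Residual.GaloisImage

namespace OneUnits

open Representation

variable {K : Type*} [Field K] {E : Type*} [Field E] [Algebra K E] [ValuativeRel E]
  [TopologicalSpace E] [IsNonarchimedeanLocalField E]
variable (p : ℕ) [hp : Fact p.Prime]

/-! ### The digit map at every level `k ≥ 1` -/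

section DigitLevel

omit hp [ValuativeRel E] [TopologicalSpace E] [IsNonarchimedeanLocalField E] in
/-- The digit `(u - 1)/p^k` of `u = 1 + p^k b` is `b`. [folklore] -/
theorem digit_eq_level (hp0 : (p : E) ≠ 0) {k : ℕ} {u b : E} (hu : u = 1 + (p : E) ^ k * b) :
    (u - 1) / (p : E) ^ k = b := by
  rw [hu, add_sub_cancel_left, mul_div_cancel_left₀ _ (pow_ne_zero _ hp0)]

omit hp [TopologicalSpace E] [IsNonarchimedeanLocalField E] in
/-- **The digit map at level `k ≥ 1`**, `U_k → 𝒪_E/p𝒪_E`, `1 + p^k b ↦ b mod p`: a surjective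
`Gal(E/K)`-equivariant homomorphism with kernel `U_{k+1}` (Serre's
`U^n/U^{n+1} ≅ 𝔭^n/𝔭^{n+1}`). [cite: SerreLocalFields1979, IV §2 Prop. 6] -/
theorem exists_digitHom_level (hpv : ValuativeRel.valuation E p < 1) (hp0 : (p : E) ≠ 0) {k : ℕ} (hk : 1 ≤ k)
    (U₂ U₃ : Submodule ℤ (Additive Eˣ))
    (hU₂ : ∀ u : Additive Eˣ, u ∈ U₂ ↔ ∃ b ∈ 𝒪[E], ((Additive.toMul u : Eˣ) : E) = 1 + (p : E) ^ k * b)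
    (hU₃ : ∀ u : Additive Eˣ, u ∈ U₃ ↔ ∃ b ∈ 𝒪[E], ((Additive.toMul u : Eˣ) : E) = 1 + (p : E) ^ (k + 1) * b)
    (hU₂st : ∀ σ, U₂ ≤ U₂.comap (Representation.ofMulDistribMulAction (E ≃ₐ[K] E) Eˣ σ))
    (O : Submodule ℤ E) (hO : ∀ x, x ∈ O ↔ x ∈ 𝒪[E])
    (hOst : ∀ σ, O ≤ O.comap (Representation.ofDistribMulAction ℤ (E ≃ₐ[K] E) E σ)) :
    ∃ φ : IntertwiningMap ((Representation.ofMulDistribMulAction (E ≃ₐ[K] E) Eˣ).subrepresentation U₂ hU₂st)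
        (((Representation.ofDistribMulAction ℤ (E ≃ₐ[K] E) E).subrepresentation O hOst).quotient _
          (ModPRepCount.range_lsmul_le_comap
            ((Representation.ofDistribMulAction ℤ (E ≃ₐ[K] E) E).subrepresentation O hOst) p)),
      Surjective φ ∧ ∀ u : U₂, φ u = 0 ↔ (u : Additive Eˣ) ∈ U₃ := by
  set ρU := Representation.ofMulDistribMulAction (E ≃ₐ[K] E) Eˣ with hρU
  set ρE := Representation.ofDistribMulAction ℤ (E ≃ₐ[K] E) E with hρE
  set ρO := ρE.subrepresentation O hOst with hρO
  set PO : Submodule ℤ O := LinearMap.range (LinearMap.lsmul ℤ O p) with hPO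
  -- the digit
  have hd : ∀ u : U₂, (((Additive.toMul (u : Additive Eˣ) : Eˣ) : E) - 1) / (p : E) ^ k ∈ O := fun u => by
    obtain ⟨b, hb, hub⟩ := (hU₂ u).1 u.2
    rw [digit_eq_level p hp0 hub, hO]; exact hb
  let d : U₂ → O := fun u => ⟨_, hd u⟩
  have d_spec : ∀ (u : U₂) {b : E}, ((Additive.toMul (u : Additive Eˣ) : Eˣ) : E) = 1 + (p : E) ^ k * b →
      (d u : E) = b := fun u b hub => digit_eq_level p hp0 hub
  -- additivity modulo `p`
  have d_add : ∀ u w : U₂, PO.mkQ (d (u + w)) = PO.mkQ (d u) + PO.mkQ (d w) := by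
    intro u w
    obtain ⟨a, ha, hua⟩ := (hU₂ u).1 u.2
    obtain ⟨b, hb, hwb⟩ := (hU₂ w).1 w.2
    have huw : ((Additive.toMul ((u + w : U₂) : Additive Eˣ) : Eˣ) : E) =
        1 + (p : E) ^ k * (a + b + (p : E) ^ k * a * b) := by
      rw [Submodule.coe_add, toMul_add, Units.val_mul, hua, hwb]; ring
    rw [← map_add, ← sub_eq_zero, ← map_sub, Submodule.mkQ_apply, Submodule.Quotient.mk_eq_zero, hPO,
      LinearMap.mem_range]
    refine ⟨⟨(p : E) ^ (k - 1) * a * b, (hO _).2 (Subring.mul_mem _ (Subring.mul_mem _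
      (Subring.pow_mem _ ((Valuation.mem_integer_iff _ _).2 hpv.le) _) ha) hb)⟩, Subtype.ext ?_⟩
    rw [LinearMap.lsmul_apply, Submodule.coe_smul_of_tower, Submodule.coe_sub, Submodule.coe_add,
      d_spec _ huw, d_spec _ hua, d_spec _ hwb]
    simp only [zsmul_eq_mul, Int.cast_natCast]
    obtain ⟨k', rfl⟩ := Nat.exists_eq_add_of_le hk
    simp only [Nat.add_sub_cancel_left, pow_succ, pow_add]
    ring
  let ψ : U₂ →+ O ⧸ PO := AddMonoidHom.mk' (fun u => PO.mkQ (d u)) d_add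
  have hψ : ∀ u : U₂, ψ u = PO.mkQ (d u) := fun u => rfl
  -- equivariance
  have d_smul : ∀ (σ : E ≃ₐ[K] E) (u : U₂),
      d ((ρU.subrepresentation U₂ hU₂st) σ u) = ρO σ (d u) := by
    intro σ u
    obtain ⟨b, hb, hub⟩ := (hU₂ u).1 u.2
    have hσu : ((Additive.toMul (((ρU.subrepresentation U₂ hU₂st) σ u : U₂) : Additive Eˣ) : Eˣ) : E) =
        1 + (p : E) ^ k * σ b := by
      change ((Additive.toMul (ρU σ (u : Additive Eˣ)) : Eˣ) : E) = _
      rw [coe_ofMulDistribMulAction_apply, hub]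
      simp [map_add, map_mul, map_pow]
    refine Subtype.ext ?_
    rw [d_spec _ hσu]
    change σ b = σ • ((d u : O) : E)
    rw [AlgEquiv.smul_def, d_spec _ hub]
  refine ⟨ψ.toIntLinearMap.intertwiningMap_of_isIntertwiningMap _ _ (fun σ u => ?_), ?_, ?_⟩
  · change ψ ((ρU.subrepresentation U₂ hU₂st) σ u) = (ρO.quotient PO _) σ (ψ u)
    rw [hψ, hψ, d_smul, Representation.quotient_apply, Submodule.mkQ_apply, Submodule.mkQ_apply,
      Submodule.mapQ_apply]
  · -- surjective
    intro q
    obtain ⟨x, rfl⟩ := Submodule.mkQ_surjective PO q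
    have hx : (x : E) ∈ 𝒪[E] := (hO _).1 x.2
    have hne : (1 + (p : E) ^ k * (x : E)) ≠ 0 := fun h0 => by
      have := valuation_one_add_eq_one p hpv hk hx (E := E)
      rw [h0, map_zero] at this
      exact zero_ne_one this
    have hmem : Additive.ofMul (Units.mk0 _ hne) ∈ U₂ := (hU₂ _).2 ⟨x, hx, rfl⟩
    refine ⟨⟨_, hmem⟩, ?_⟩
    change ψ ⟨_, hmem⟩ = _
    rw [hψ, Submodule.mkQ_apply]
    exact congrArg _ (Subtype.ext (d_spec ⟨_, hmem⟩ rfl))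
  · -- kernel
    intro u
    obtain ⟨b, hb, hub⟩ := (hU₂ u).1 u.2
    change ψ u = 0 ↔ _
    rw [hψ, Submodule.mkQ_apply, Submodule.Quotient.mk_eq_zero, hPO, LinearMap.mem_range, hU₃]
    constructor
    · rintro ⟨c, hc⟩
      have hc' := congrArg (fun t : O => (t : E)) hc
      simp only [LinearMap.lsmul_apply, Submodule.coe_smul_of_tower, d_spec _ hub, zsmul_eq_mul,
        Int.cast_natCast] at hc'
      refine ⟨(c : E), (hO _).1 c.2, ?_⟩
      rw [hub, ← hc']; ring
    · rintro ⟨c, hc, huc⟩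
      refine ⟨⟨c, (hO _).2 hc⟩, Subtype.ext ?_⟩
      rw [LinearMap.lsmul_apply, Submodule.coe_smul_of_tower, d_spec _ hub, zsmul_eq_mul, Int.cast_natCast]
      have h2 : (1 : E) + (p : E) ^ k * b = 1 + (p : E) ^ (k + 1) * c := hub.symm.trans huc
      have h3 : (p : E) ^ k * (b - p * c) = 0 := by rw [pow_succ] at h2; linear_combination h2
      rcases mul_eq_zero.1 h3 with h | h
      · exact absurd h (pow_ne_zero _ hp0)
      · change (p : E) * c = b; linear_combination -h

end DigitLevel

/-! ### Finiteness -/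

section Finiteness

omit hp [ValuativeRel E] [TopologicalSpace E] [IsNonarchimedeanLocalField E] in
/-- The `p`-torsion of any subgroup `U ≤ Eˣ` is finite (it embeds in `μ_p(E)`). [folklore] -/
theorem finite_ker_lsmul [NeZero p] (U : Submodule ℤ (Additive Eˣ)) :
    Finite (LinearMap.ker (LinearMap.lsmul ℤ U p)) := by
  classical
  refine Finite.of_injective (fun t : LinearMap.ker (LinearMap.lsmul ℤ U p) =>
    (⟨Additive.toMul ((t : U) : Additive Eˣ), ?_⟩ : rootsOfUnity p E)) ?_
  · have ht := t.2
    rw [LinearMap.mem_ker, LinearMap.lsmul_apply, natCast_zsmul] at ht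
    have ht' := congrArg (fun x : U => Additive.toMul (x : Additive Eˣ)) ht
    simp only [Submodule.coe_smul_of_tower, toMul_nsmul, Submodule.coe_zero, toMul_zero] at ht'
    exact (mem_rootsOfUnity _ _).2 ht'
  · intro a b h
    have h' : Additive.toMul ((a : U) : Additive Eˣ) = Additive.toMul ((b : U) : Additive Eˣ) :=
      congrArg (fun x : rootsOfUnity p E => (x : Eˣ)) h
    exact Subtype.ext (Subtype.ext (Additive.toMul.injective h'))

end Finiteness

/-! ### The step `U_1 ⊇ U_2`: `#Hom_Δ(Z, U_1/p) = #Hom_Δ(Z, 𝒪_E/p) · #Hom_Δ(Z, U_1[p])` -/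

section StepOne

variable [FiniteDimensional K E]

/-- **`[U_1/U_1^p] = [𝒪_E/p] + [U_1[p]]` counted by `#Hom_Δ(Z, ·)`** (`Δ = Gal(E/K)`, `p ∤ #Δ`,
`Z` finite killed by `p`): Milne's Lemma 2.12 step for `U_1^p ≤ U_2 ≤ U_1` (`U_2` has no
`p`-torsion) together with `U_2/U_2^p ≃ 𝒪_E/p𝒪_E`.
[cite: MilneADT2006, I §2 proof of Thm 2.8 (Lemma 2.12, p. 34)] -/
theorem natCard_modP_one [CharZero E] (hpv : ValuativeRel.valuation E p < 1)
    (hG : ¬ p ∣ Nat.card (E ≃ₐ[K] E))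
    {Z : Type*} [AddCommGroup Z] [Finite Z] (σZ : Representation ℤ (E ≃ₐ[K] E) Z)
    (hZ : ∀ z : Z, p • z = 0)
    (U₁ U₂ U₃ : Submodule ℤ (Additive Eˣ))
    (hU₁ : ∀ u : Additive Eˣ, u ∈ U₁ ↔ ∃ b ∈ 𝒪[E], ((Additive.toMul u : Eˣ) : E) = 1 + (p : E) ^ 1 * b)
    (hU₂ : ∀ u : Additive Eˣ, u ∈ U₂ ↔ ∃ b ∈ 𝒪[E], ((Additive.toMul u : Eˣ) : E) = 1 + (p : E) ^ 2 * b)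
    (hU₃ : ∀ u : Additive Eˣ, u ∈ U₃ ↔ ∃ b ∈ 𝒪[E], ((Additive.toMul u : Eˣ) : E) = 1 + (p : E) ^ 3 * b)
    (hU₁st : ∀ σ, U₁ ≤ U₁.comap (Representation.ofMulDistribMulAction (E ≃ₐ[K] E) Eˣ σ))
    (hU₂st : ∀ σ, U₂ ≤ U₂.comap (Representation.ofMulDistribMulAction (E ≃ₐ[K] E) Eˣ σ))
    (O : Submodule ℤ E) (hO : ∀ x, x ∈ O ↔ x ∈ 𝒪[E])
    (hOst : ∀ σ, O ≤ O.comap (Representation.ofDistribMulAction ℤ (E ≃ₐ[K] E) E σ)) :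
    Nat.card (IntertwiningMap σZ (((Representation.ofMulDistribMulAction (E ≃ₐ[K] E) Eˣ).subrepresentation
        U₁ hU₁st).quotient _ (ModPRepCount.range_lsmul_le_comap
          ((Representation.ofMulDistribMulAction (E ≃ₐ[K] E) Eˣ).subrepresentation U₁ hU₁st) p))) =
    Nat.card (IntertwiningMap σZ ((((Representation.ofDistribMulAction ℤ (E ≃ₐ[K] E) E).subrepresentation
        O hOst).quotient _ (ModPRepCount.range_lsmul_le_comap
          ((Representation.ofDistribMulAction ℤ (E ≃ₐ[K] E) E).subrepresentation O hOst) p)))) *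
    Nat.card (IntertwiningMap σZ (((Representation.ofMulDistribMulAction (E ≃ₐ[K] E) Eˣ).subrepresentation
        U₁ hU₁st).subrepresentation _ (ModPRepCount.ker_lsmul_le_comap
          ((Representation.ofMulDistribMulAction (E ≃ₐ[K] E) Eˣ).subrepresentation U₁ hU₁st) p))) := by
  classical
  have hp0 : (p : E) ≠ 0 := Nat.cast_ne_zero.2 hp.out.ne_zero
  -- inclusions
  have hle : U₂ ≤ U₁ := antitone p hpv U₁ U₂ hU₁ hU₂
  have hpW : ∀ w ∈ U₁, (p : ℤ) • w ∈ U₂ := fun w hw => by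
    rw [natCast_zsmul]; exact nsmul_mem_succ p hpv le_rfl U₁ U₂ hU₁ hU₂ hw
  -- finiteness of `U₁[p]`
  haveI : Finite (LinearMap.ker (LinearMap.lsmul ℤ U₁ p)) := finite_ker_lsmul p U₁
  -- finiteness of `U₁/pU₁`: kernel and range of the map to `𝒪/p` induced by the level-1 digit
  haveI : Finite (U₁ ⧸ LinearMap.range (LinearMap.lsmul ℤ U₁ p)) := by
    obtain ⟨φ₁, hφ₁s, hφ₁k⟩ := exists_digitHom_level p hpv hp0 le_rfl U₁ U₂ hU₁
      (by simpa only [show (1 : ℕ) + 1 = 2 from rfl] using hU₂) hU₁st O hO hOst (K := K)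
    obtain ⟨-, hfinO⟩ := natCard_quotient_two_eq p hpv U₂ hU₂ (E := E)
    haveI := hfinO
    haveI : Finite (O ⧸ LinearMap.range (LinearMap.lsmul ℤ O p)) := by
      refine Nat.finite_of_card_ne_zero ?_
      rw [natCard_quotient_integer_eq p O hO]
      exact Nat.card_pos.ne'
    haveI : Finite (U₂ ⧸ LinearMap.range (LinearMap.lsmul ℤ U₂ p)) := by
      refine Nat.finite_of_card_ne_zero ?_
      rw [(natCard_quotient_two_eq p hpv U₂ hU₂ (E := E)).1]
      exact Nat.card_pos.ne'
    -- `Ψ : U₁/pU₁ → 𝒪/p`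
    have hleker : LinearMap.range (LinearMap.lsmul ℤ U₁ p) ≤ LinearMap.ker φ₁.toLinearMap := by
      rintro _ ⟨u, rfl⟩
      rw [LinearMap.mem_ker]
      change φ₁ ((p : ℤ) • u) = 0
      rw [hφ₁k, Submodule.coe_smul_of_tower]
      exact hpW _ u.2
    let Ψ := (LinearMap.range (LinearMap.lsmul ℤ U₁ p)).liftQ φ₁.toLinearMap hleker
    -- kernel of `Ψ` = image of `U₂`, a quotient of the finite `U₂/pU₂`
    let ι : U₂ →ₗ[ℤ] U₁ := Submodule.inclusion hle
    have hιp : LinearMap.range (LinearMap.lsmul ℤ U₂ p) ≤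
        (LinearMap.range (LinearMap.lsmul ℤ U₁ p)).comap ι := by
      rintro _ ⟨u, rfl⟩
      exact ⟨ι u, by simp [LinearMap.lsmul_apply]⟩
    let κ := (LinearMap.range (LinearMap.lsmul ℤ U₂ p)).mapQ _ ι hιp
    have hker : ∀ x, Ψ x = 0 → x ∈ LinearMap.range κ := by
      intro x hx
      obtain ⟨u, rfl⟩ := Submodule.mkQ_surjective _ x
      have hu2 : ((u : U₁) : Additive Eˣ) ∈ U₂ := (hφ₁k u).1 hx
      exact ⟨Submodule.Quotient.mk ⟨_, hu2⟩, rfl⟩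
    haveI : Finite (LinearMap.range κ) := Finite.of_surjective _ (LinearMap.surjective_rangeRestrict κ)
    haveI : Finite Ψ.toAddMonoidHom.ker :=
      Finite.of_injective (fun x : Ψ.toAddMonoidHom.ker => (⟨x.1, hker x.1 x.2⟩ : LinearMap.range κ))
        fun a b h => Subtype.ext (congrArg
          (fun t : LinearMap.range κ => (t : U₁ ⧸ LinearMap.range (LinearMap.lsmul ℤ U₁ p))) h)
    haveI : Finite Ψ.toAddMonoidHom.range := Finite.of_injective _ Subtype.coe_injective
    exact (AddMonoidHom.finite_iff_finite_ker_range Ψ.toAddMonoidHom).2 ⟨inferInstance, inferInstance⟩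
  -- the Herbrand step (stage A3) for `pU₁ ≤ U₂ ≤ U₁`
  haveI : Finite (E ≃ₐ[K] E) := inferInstance
  have step := ModPRepCount.natCard_modP_mul_natCard_torsion_eq_of_le
    (Representation.ofMulDistribMulAction (E ≃ₐ[K] E) Eˣ) σZ hG hZ U₁ U₂ hU₁st hU₂st hle hpW
  -- `U₂[p] = 0`
  haveI : Subsingleton (LinearMap.ker (LinearMap.lsmul ℤ U₂ p)) := by
    refine ⟨fun a b => Subtype.ext ?_⟩
    have h0 : ∀ c : LinearMap.ker (LinearMap.lsmul ℤ U₂ p), (c : U₂) = 0 := fun c => by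
      have hc := c.2
      rw [LinearMap.mem_ker, LinearMap.lsmul_apply, natCast_zsmul] at hc
      have hc' : p • ((c : U₂) : Additive Eˣ) = 0 := by
        have := congrArg (fun x : U₂ => (x : Additive Eˣ)) hc
        simpa only [Submodule.coe_smul_of_tower, Submodule.coe_zero] using this
      exact Subtype.ext (torsionFree_two p hpv hp.out.ne_zero U₂ hU₂ (c : U₂).2 hc')
    rw [h0 a, h0 b]
  rw [ModPRepCount.natCard_intertwiningMap_of_subsingleton, mul_one] at step
  -- `U₂/pU₂ ≃ 𝒪/p`
  obtain ⟨eQ⟩ := nonempty_equiv_modP_two p hpv U₂ U₃ hU₂ hU₃ hU₂st O hO hOst (K := K)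
  have t : Nat.card (IntertwiningMap σZ (((Representation.ofMulDistribMulAction (E ≃ₐ[K] E) Eˣ).subrepresentation
        U₂ hU₂st).quotient _ (ModPRepCount.range_lsmul_le_comap
          ((Representation.ofMulDistribMulAction (E ≃ₐ[K] E) Eˣ).subrepresentation U₂ hU₂st) p))) =
      Nat.card (IntertwiningMap σZ ((((Representation.ofDistribMulAction ℤ (E ≃ₐ[K] E) E).subrepresentation
        O hOst).quotient _ (ModPRepCount.range_lsmul_le_comap
          ((Representation.ofDistribMulAction ℤ (E ≃ₐ[K] E) E).subrepresentation O hOst) p)))) :=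
    ModPRepCount.natCard_intertwiningMap_congr_right σZ _ _ eQ
  rw [t] at step
  exact step

end StepOne

end OneUnits

end Summit.BirchSwinnertonDyer.Rank1Residual.GaloisImage

end
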